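import Mathlib
import HarnessLib
import Summits.HubbardSuperconductivity.HubbardSuperconductivity.Theorems.KLProgrammeKLRegimeEngineTowerRemeasureSplit
import Summits.HubbardSuperconductivity.HubbardSuperconductivity.Theorems.KLProgrammeKLRegimeOverlapWtJumpFlowAll

/-!
# Route `KLProgramme` — crux K3 ENGINE (stmt-HubbardSuperconductivity-20437 `KLRegimeEngineV17F2`), stub (b) v2, THE LEVELS PACKAGE (ℓ):
# instantiation (I2), THE SPLIT JUMP (off / on a class of coarse tuples), weighted track, AT THE FLOW FRAME WITH NO DEPTH WINDOW — the `_flow_all` re-key (X3)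
# of k3c2-p3's `klWtPinnedSumAt_jump_le_split_klEng_flow_deep` (located item «(I2)-WT-WINDOW»; cell gate-hubbard-kl, seat p4 g17, owner's concurrence 15:43Z)

`…EngineTowerRemeasureSplitKlEng` (k3c2-p3 g10) discharges the overlap constants of the split weighted jump on p3's deep window `4ⁿ·U ≤ 4^{2(k+1)+dd}`.  Here the
same composition reads the window-free general-jump overlap `TorusFourierL2.overlapWt_jump_sums_klEng_flow_all (R) (c″)` (…OverlapWtJumpFlowAll): the
narrow/wide and all-known-track consumers (…NarrowWideSplitWt, …ModelDefsWtFull §2) re-key onto this row by swapping one name and dropping the window binder.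

* **`klWtPinnedSumAt_jump_le_split_klEng_flow_all (m) (R) (c″)`** — `∃ C_m > 0` (`= (3C_J/2)^{m+1}`): W5's binder list, every `k + 1 ≤ J′ ≤ n`, rate `j ≥ J′`,
  any class `B`, abstract split counts `A₁`/`A₂`: `klWtPinnedSumAt … J′ j (m+1) T q w ≤ C_m·(A₁·N + A₂·N_B)` at `K = K_n`.
Everything is proved; no definitions; nothing about the model is asserted; nothing asserts superconductivity.
References: BGM 2006 §2.8 (2.82)–(2.84), (2.88)–(2.90), §3 (3.2)–(3.8), App. A3 Lemma A3.1 [cite: BenfattoGiulianiMastropietro2006].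
-/

noncomputable section

namespace Summit.HubbardSuperconductivity.HubbardSuperconductivity.Theorems.EngineV8

set_option linter.dupNamespace false -- summit = problem name (single-conjunct summit), D-0017

open Classical
open Real Finset Literature.MathematicalPhysics.QuantumLattice Literature.Probability.LatticeModels GrassmannAlgebra
open Literature.Probability.LatticeModels.BattleFederbush
open Literature.MathematicalPhysics.QuantumLattice.FermiRG
open Summit.HubbardSuperconductivity.HubbardSuperconductivity.Theorems.KLRegimeSplit
open Summit.HubbardSuperconductivity.HubbardSuperconductivity.Theorems.KLProgrammeLegKernels
open Summit.HubbardSuperconductivity.HubbardSuperconductivity.Theorems.DispersionFlow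
open Summit.HubbardSuperconductivity.HubbardSuperconductivity.Theorems.KLRegimeWick
open Summit.HubbardSuperconductivity.HubbardSuperconductivity.Theorems.TorusFourierL2

/-! ## The split weighted jump at the flow frame, no window -/

/-- **THE WEIGHTED SPLIT JUMP AT THE FLOW FRAME, NO DEPTH WINDOW, overlap constants discharged** — k3c2-p3's
`klWtPinnedSumAt_jump_le_split_klEng_flow_deep` with p3's windowed overlap replaced by `overlapWt_jump_sums_klEng_flow_all (R) (c″)` (W5's binder list:
`c″U ≤ 1`, `IsKLRegime U cc (−n)`, the REGISTERED (K5′) clauses; NO window, NO `FrameOK` binder); every rate `j ≥ J′`; counts kept abstract: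
`klWtPinnedSumAt … J′ j (m+1) T q w ≤ C_m·(A₁·N + A₂·N_B)` at `K = K_n`. [cite: BenfattoGiulianiMastropietro2006, §2.8 (2.82)-(2.84), (2.88)-(2.90), App. A3] -/
theorem klWtPinnedSumAt_jump_le_split_klEng_flow_all (m : ℕ) (R : RenConsts) (c'' : ℝ) (hc'' : 0 ≤ c'') :
    ∃ C : ℝ, 0 < C ∧
      ∀ (G : GeoConsts) (P : SplitConsts) (Q : EngConsts) (cc : ℝ), R.WF2 → 0 < cc → cc ≤ klEngC₃6 P R →
      ∀ μ ∈ klWindowC, ∀ U : ℝ, 0 < U → U ≤ min (klEngU₀3 P R cc) (1 / (R.Gfr 3 + 1)) → c'' * U ≤ 1 →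
      ∀ β : ℝ, klBetaMin ≤ β → β ≤ Real.exp (cc / U ^ 2) →
      ∀ (L M : ℕ) [NeZero L] [NeZero M], klEngL₃ β U ≤ L → klEngM₃ β U L ≤ M →
      ∀ n : ℕ, 1 ≤ n → n ≤ nScales β + 1 → IsKLRegime U cc (-(n : ℤ)) → HistP klPredsV17F2 L M G P Q R β U μ 0 n →
        (∀ m', 1 ≤ m' → m' < n → FlowPieceOscAt L M c'' β U μ m') →
        ∀ k J' : ℕ, k + 1 ≤ J' → J' ≤ n →
        ∀ T : HubbardGrassmann L M,
          (∀ (m' : ℕ) (X : Fin m' → HubbardFieldIdx L M), ∑ i, signedMomentum L (X i).2 (X i).1.1.2 ≠ 0 → kernel ℂ T m' X = 0) →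
        ∀ j : ℕ, J' ≤ j → ∀ (B : Finset (Fin (m + 1) → SectorLeg (sectorCount k))) (q : Fin (m + 1))
          (w : SpaceTimeIdx L M × SectorLeg (sectorCount J')) (A₁ A₂ N NB : ℝ), 0 ≤ A₁ → 0 ≤ A₂ → 0 ≤ N → 0 ≤ NB →
          (∀ (ℓ'' : SectorLeg (sectorCount J')) (σ' : Fin (m + 1) → SectorLeg (sectorCount k)), σ' ∉ B →
            (27 : ℝ) * ((((bgmSectorSet L M (klAnisoFamily L M β μ (klFlowFrameU L M β U μ n) klE0 J') (m + 1)).filter fun σ'' =>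
              (∀ e ∈ ({q} : Finset (Fin (m + 1))), σ'' e = (fun _ : Fin (m + 1) => ℓ'') e) ∧ ∀ i,
              (∃ q' : FreqMomentum L M, klAnisoFamily L M β μ (klFlowFrameU L M β U μ n) klE0 J' (σ'' i).1.1 q' ≠ 0 ∧
                bgmFatMultiplier L M klE0 β (nambuXiCT L μ (klFlowFrameU L M β U μ n)) k (σ' i).1.1 q' ≠ 0) ∧
              (σ' i).1.2 = (σ'' i).1.2 ∧ (σ' i).2 = (σ'' i).2).card : ℝ)) ≤ A₁) →
          (∀ (ℓ'' : SectorLeg (sectorCount J')) (σ' : Fin (m + 1) → SectorLeg (sectorCount k)), σ' ∈ B →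
            (27 : ℝ) * ((((bgmSectorSet L M (klAnisoFamily L M β μ (klFlowFrameU L M β U μ n) klE0 J') (m + 1)).filter fun σ'' =>
              (∀ e ∈ ({q} : Finset (Fin (m + 1))), σ'' e = (fun _ : Fin (m + 1) => ℓ'') e) ∧ ∀ i,
              (∃ q' : FreqMomentum L M, klAnisoFamily L M β μ (klFlowFrameU L M β U μ n) klE0 J' (σ'' i).1.1 q' ≠ 0 ∧
                bgmFatMultiplier L M klE0 β (nambuXiCT L μ (klFlowFrameU L M β U μ n)) k (σ' i).1.1 q' ≠ 0) ∧
              (σ' i).1.2 = (σ'' i).1.2 ∧ (σ' i).2 = (σ'' i).2).card : ℝ)) ≤ A₂) →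
          (∀ w' : SpaceTimeIdx L M × SectorLeg (sectorCount k),
            klWtPinnedSumAt L M β μ (klFlowFrameU L M β U μ n) k j (m + 1) T q w' ≤ N) →
          (∀ (ℓ' : SectorLeg (sectorCount k)) (y' : SpaceTimeIdx L M),
            imagTimeWeight β M ^ m * ∑ σ' ∈ B.filter (fun σ' : Fin (m + 1) → SectorLeg (sectorCount k) => σ' q = ℓ'),
              ∑ x' ∈ univ.filter (fun x' : Fin (m + 1) → SpaceTimeIdx L M => x' q = y'),
                klScaleWt L M β j ((univ.image x').image (fun x : SpaceTimeIdx L M => (((((2 * (x.1 : ℕ) : ℕ)) : ZMod (2 * (2 * M)))), x.2))) *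
                  ‖sectorisedKernel L M β (klAnisoFamily L M β μ (klFlowFrameU L M β U μ n) klE0 k) T (m + 1) σ' x'‖ ≤ NB) →
          klWtPinnedSumAt L M β μ (klFlowFrameU L M β U μ n) J' j (m + 1) T q w ≤ C * (A₁ * N + A₂ * NB) := by
  obtain ⟨CJ, hCJ, hov⟩ := overlapWt_jump_sums_klEng_flow_all R c'' hc''
  refine ⟨(3 * CJ / 2) ^ (m + 1), by positivity, ?_⟩
  intro G P Q cc hR2 hcc hcc6 μ hμ U hU hUle hcU β hβmin hβc L M _ _ hL3 hM3 n hn1 hnN hkl hhist hosc k J' hJ hJn T hT j hjJ B q w A₁ A₂ N NB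
    hA₁ hA₂ hN0 hNB0 hRoff hRon hN hNB
  have hβ : 0 < β := KLRegimeSplit.pos_of_klBetaMin_le hβmin
  set K : TrigPolyC4v := klFlowFrameU L M β U μ n with hK
  obtain ⟨_, hcolJ, hrowJ⟩ := hov G P Q cc hR2 hcc hcc6 μ hμ U hU hUle hcU β hβmin hβc L M hL3 hM3 n hn1 hnN hkl hhist hosc k J' hJ hJn
  have hc₁0 : (0 : ℝ) ≤ 3 * CJ * M / β := by positivity
  have hcol₁ : ∀ (ω'' : Fin (sectorCount J')) (ω' : Fin (sectorCount k)) (σ c : Fin 2) (x' : SpaceTimeIdx L M),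
      ∑ x'' : SpaceTimeIdx L M, ‖(sectorAnalysisMatrix L M β (klAnisoFamily L M β μ K klE0 J') *
        sectorSubMatrix L M β (bgmFatMultiplier L M klE0 β (nambuXiCT L μ K) k)) (x'', ((ω'', σ), c)) (x', ((ω', σ), c))‖ *
          klScaleWt L M β j
            {latticeLegPos (2 * (2 * M)) ((x'', ((ω'', σ), c)) : SpaceTimeIdx L M × SectorLeg (sectorCount J')),
              latticeLegPos (2 * (2 * M)) ((x', ((ω', σ), c)) : SpaceTimeIdx L M × SectorLeg (sectorCount k))} ≤ 3 * CJ * M / β := by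
    intro ω'' ω' σ c x'
    refine le_trans (sum_le_sum fun x'' _ => mul_le_mul_of_nonneg_left (klScaleWt_le_of_le β hjJ _) (norm_nonneg _)) ?_
    exact hcolJ ω'' ω' σ c x'
  have hrow₁ : ∀ (ω'' : Fin (sectorCount J')) (ω' : Fin (sectorCount k)) (σ c : Fin 2) (x'' : SpaceTimeIdx L M),
      ∑ x' : SpaceTimeIdx L M, ‖(sectorAnalysisMatrix L M β (klAnisoFamily L M β μ K klE0 J') *
        sectorSubMatrix L M β (bgmFatMultiplier L M klE0 β (nambuXiCT L μ K) k)) (x'', ((ω'', σ), c)) (x', ((ω', σ), c))‖ *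
          klScaleWt L M β j
            {latticeLegPos (2 * (2 * M)) ((x'', ((ω'', σ), c)) : SpaceTimeIdx L M × SectorLeg (sectorCount J')),
              latticeLegPos (2 * (2 * M)) ((x', ((ω', σ), c)) : SpaceTimeIdx L M × SectorLeg (sectorCount k))} ≤ 3 * CJ * M / β := by
    intro ω'' ω' σ c x''
    refine le_trans (sum_le_sum fun x' _ => mul_le_mul_of_nonneg_left (klScaleWt_le_of_le β hjJ _) (norm_nonneg _)) ?_
    exact hrowJ ω'' ω' σ c x''
  have h := klWtPinnedSumAt_jump_le_split_of_consts hβ μ K hJ T hT j hc₁0 hc₁0 hcol₁ hrow₁ m B q w hA₁ hA₂ hN0 hNB0 hRoff hRon hN hNB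
  have hMne : (M : ℝ) ≠ 0 := by exact_mod_cast NeZero.ne M
  have hεc : imagTimeWeight β M * (3 * CJ * M / β) = 3 * CJ / 2 := by
    unfold imagTimeWeight; field_simp
  have hconst : (3 * CJ * M / β) ^ m * (3 * CJ * M / β) * imagTimeWeight β M ^ (m + 1) = (3 * CJ / 2) ^ (m + 1) := by
    rw [← pow_succ, ← mul_pow, mul_comm (3 * CJ * M / β), hεc]
  calc klWtPinnedSumAt L M β μ K J' j (m + 1) T q w
      ≤ (3 * CJ * M / β) ^ m * (3 * CJ * M / β) * imagTimeWeight β M ^ (m + 1) * (A₁ * N + A₂ * NB) := h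
    _ = (3 * CJ / 2) ^ (m + 1) * (A₁ * N + A₂ * NB) := by rw [hconst]

end Summit.HubbardSuperconductivity.HubbardSuperconductivity.Theorems.EngineV8

end
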